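import Summits.QuantumFields.BalabanUV.Beta.CompositeCorrectorFormsGeneric

/-!
# `BalabanUV.Beta.CompositeCorrectorLocalityGeneric` — binder row D1 ∕ (C1): **THE SCHEME-GENERIC COMPOSITE CORRECTORS READ FINITELY MANY BONDS** — leaf-06 g32's
# `CompositeCorrectorLocality` §3 (`depOn_compLinAvgAt ∕ depOn_compDefectAt ∕ depOn_corrPsi ∕ depOn_corrPhi`) re-proved for ANY one-step averaging family from two one-step READ
# letters (§1), and INSTANTIATED at the (0.4)-SYMMETRISED scheme (§2–§3): **`depOn_symLinAvgAt`** (one level), **`depOn_compLinAvgSymAt`**, **`depOn_compDefectSymAt`**,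
# **`depOn_corrPsiSym`**, **`depOn_corrPhiSym`** — the (0.4) composite correctors `Ψˢ_m ∕ Φˢ_m` of PART 126 read exactly the rooted correctors' read set `CorrReads (L^m) α x`
# (range `0` in block units) — K-U3d-sym's FOURTH form-level brick: the locality input of any future kernelisation `kerOf Ψˢ_m` (row OWNER an2 gen 89; sequel of PART 124–126)

HONEST FRAMING (cell charter, verbatim): «discharging BetaPertH makes Balaban's UV stability UNCONDITIONAL — a real
constructive-QFT result; it is NOT the continuum limit and NOT the Clay problem.»
HONEST DEPENDENCY: continuum YM on T⁴ ⇐ BetaPertH ∧ nine spine estimates (0/9 proved); BetaPertH ⇐ (D1) ∧ (D4) ∧ CAP+tail;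
G-an2-4 gates asym, D1 and NE2/3/4.
ABSOLUTE RULE (cell, verbatim): «No internally-minted statement may enter as a cited fact. Every hypothesis is either kernel-proved in this
package or a verbatim quotation of a PUBLISHED theorem with page reference. The manuscript(s) under audit are NOT citable for their own
disputed steps — they are the thing under adjudication; programme-internal (2001/route/tribunal) claims are never citable.»
NOTHING below is cited: no `[cite: …]`, no `Prop` fact, no `def`.  [folklore] finite-sum bookkeeping over the cell's OWN typed objects BY NAME: leaf-06 g32's read-set calculus
`CompositeCorrectorLocality.DepOn` (`mono ∕ add ∕ sub ∕ mul_left ∕ depOn_sum ∕ depOn_eval ∕ DepOn.comp`), its block letters `InBlockBond ∕ InPair ∕ InPairBond ∕ CorrReads`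
(`inPair_of_blk_eq ∕ _add ∕ inPair_seg ∕ inPair_pow_succ ∕ blk_pow_succ_eq_of_inPair ∕ blk_pow_succ' ∕ blk_one`), an2's `SymCorrectorForms.depOn_symAxial ∕ depOn_zetaS` (one (0.4) block),
PART 124's `compAvOf ∕ compDefectOf ∕ avSym ∕ lamSym ∕ compLinAvgSymAt ∕ compDefectSymAt` and PART 126's `corrPhiOf ∕ corrPsiOf ∕ corrPhiSym ∕ corrPsiSym`.  It asserts nothing
about Bałaban's non-linear averages beyond their typed linearisations; it values nothing; option L of REFEREE-TABLE-89 is NOT commissioned and its KERNEL level is untouched.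

WHY.  K-U3d's kernelised corrector acts on kernel columns through `comp`'s `tsum`; that the `tsum` is a finite sum equal to the form-level corrector applied to the column is
leaf-06's APPLY BRIDGE «no hypothesis on K», whose only inputs are ℝ-linearity and A FINITE READ SET (`CompositeCorrectorKernel.apply_eq_sum_of_depOn`).  PART 124–126 made the
composite corrector pair scheme-generic and instantiated it at the (0.4)-symmetrised scheme; this file supplies the matching read-set statements, so that the (0.4) pair
`Ψˢ_m ∕ Φˢ_m` has, BY NAME, every form-level letter K-U3d's kernel files consume (`corrPsi ↦ corrPsiSym`: inversion, re-linearisation, slice, flatness — PART 126; locality — here).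

WHAT (`d` the lattice dimension; `L` the block side, `0 < L`; levels `k`, `m`; all [folklore]):
§1 GENERIC (`Av : ℕ → Form1 → Form1`, `lam : ℕ → Form1 → Form0`) from the one-step READ letters
   (RA) `∀ k κ z, DepOn (InPairBond L κ z) (B ↦ Av k B κ z)` — the one-step average at the coarse bond `(κ, z)` reads only fine bonds with both endpoints in the `L`-block pair of `z`;
   (RΛ) `∀ k Y, DepOn (InBlockBond L Y) (B ↦ lam k B Y)` — the one-step defect potential at the coarse site `Y` reads only fine bonds with both endpoints in the `L`-block `Y`:
   **`depOn_compAvOf`** (level `k`: the `L^k`-block pair), **`depOn_compDefectOf`** (`ζ_m A Y`: the `L^m`-block `Y`), pointwise forms `corrPsiOf_apply ∕ corrPhiOf_apply`,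
   **`depOn_corrPsiOf`**, **`depOn_corrPhiOf`** (read set `CorrReads (L^m) α x`).
§2 ONE (0.4) LEVEL (block side `N ≥ 1`, in-block root offset `r ∈ box d N`): `depOn_segUp_sum` (the straight segment of the block pair), **`depOn_symLinAvgAt`** (the
   symmetrised rooted linear average at the coarse bond `(μ, z)` reads only bonds with both endpoints in the block pair `{z, z + e_μ}` — `depOn_symAxial` twice + the segment).
§3 THE (0.4) COMPOSITE (roots `r : ℕ → (Fin d → ℕ)` IN THEIR BLOCKS `hr : ∀ k, r k ∈ box d L` — never weakened): `depOn_avSym`, `depOn_lamSym` (the letters (RA)(RΛ) at the sym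
   data), **`depOn_compLinAvgSymAt`**, **`depOn_compDefectSymAt`**, **`depOn_corrPsiSym`**, **`depOn_corrPhiSym`** — literally leaf-06's §3 statements with
   `compLinAvgAt ∕ compDefectAt ∕ corrPsi ∕ corrPhi ↦ compLinAvgSymAt ∕ compDefectSymAt ∕ corrPsiSym ∕ corrPhiSym` and THE SAME read sets.
Namespace: PART 124's `…CompositeAveragingCoarseExactGeneric` is REOPENED on purpose (the read-set lemmas sit next to `compAvOf ∕ compDefectOf`; all names new).
Provenance: β sub-cell, unit `b2b-balaban-beta-an2` gen 89 (row-D1 OWNER), 2026-08-30; charter-neutral library typing (no L-root, no (I)-class object).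
NOT (C1), NOT (T-ID), NOT D1, NEVER «G-an2-4 closed», NOT `BetaPertH`, NOT continuum, NOT Clay.
-/

namespace Summit.QuantumFields.BalabanUV.Beta.CompositeAveragingCoarseExactGeneric

open Finset
open scoped BigOperators Nat
open Literature.MathematicalPhysics.QuantumFieldTheory.Balaban1983to89.Beta
open AffineAveraging (Site Form0 Form1 box toSite unitVec unitVec_apply dz blockSum)
open AveragingContours (blk blk_block segUp segUp_sum)
open Summit.QuantumFields.BalabanUV.Beta.AxialDressingRooted (mem_segUp_site)
open Summit.QuantumFields.BalabanUV.Beta.SymmetrisedAxialPotential (symAxial symLinAvgAt)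
open Summit.QuantumFields.BalabanUV.Beta.SymCorrectorForms (zetaS depOn_symAxial depOn_zetaS)
open Summit.QuantumFields.BalabanUV.Beta.CompositeCorrectorForms (ext ext_apply)
open Summit.QuantumFields.BalabanUV.Beta.CompositeCorrectorLocality (DepOn DepOn.mono DepOn.add DepOn.sub DepOn.mul_left DepOn.comp depOn_sum depOn_eval
  InBlockBond InPair InPairBond CorrReads inPair_of_blk_eq inPair_of_blk_eq_add inPair_seg inPair_pow_succ blk_pow_succ_eq_of_inPair blk_pow_succ' blk_one)

noncomputable section

variable {d : ℕ}

/-! ## §1 Generic: the composite, the defect potential and the correctors read finitely many bonds -/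

section Generic

variable {Av : ℕ → Form1 d ℝ → Form1 d ℝ} {lam : ℕ → Form1 d ℝ → Form0 d ℝ} {L : ℕ}

/-- [folklore] **THE LEVEL-`k` GENERIC COMPOSITE AT THE BOND `(κ, z)` READS ONLY FINE BONDS WITH BOTH ENDPOINTS IN THE `L^k`-BLOCK PAIR `{z, z + e_κ}`**, from the
one-step read letter (RA) (induction on `k` by `compAvOf_succ`; composition = leaf-06's `inPair_pow_succ`). -/
theorem depOn_compAvOf (hL : 0 < L) (hAv : ∀ (k : ℕ) (κ : Fin d) (z : Site d), DepOn (InPairBond L κ z) fun B => Av k B κ z) :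
    ∀ (k : ℕ) (κ : Fin d) (z : Site d), DepOn (InPairBond (L ^ k) κ z) fun A => compAvOf Av k A κ z
  | 0, κ, z => by
      refine ⟨fun A B hAB => ?_⟩
      show A κ z = B κ z
      apply hAB
      have h0 : ∀ w : Site d, blk (L ^ 0) w = w := fun w => by rw [pow_zero, blk_one]
      exact ⟨inPair_of_blk_eq (h0 z), inPair_of_blk_eq_add (h0 _)⟩
  | k + 1, κ, z => by
      show DepOn _ fun A => Av k (compAvOf Av k A) κ z
      refine DepOn.comp (T := fun A => compAvOf Av k A) (PT := fun q => InPairBond (L ^ k) q.1 q.2) (hAv k κ z)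
        (fun q _ => depOn_compAvOf hL hAv k q.1 q.2) ?_
      rintro ⟨κ', z'⟩ ⟨h1, h2⟩ ⟨κ'', y⟩ ⟨hy1, hy2⟩
      exact ⟨inPair_pow_succ hL hy1 h1 h2, inPair_pow_succ hL hy2 h1 h2⟩

/-- [folklore] **THE GENERIC DEFECT POTENTIAL `ζ_m A Y` READS ONLY FINE BONDS WITH BOTH ENDPOINTS IN THE `L^m`-BLOCK `Y`**, from (RA) and (RΛ) (induction on `m` by
`compDefectOf_succ`: the block sum of `ζ_m` over the `L`-block of `Y`, and the one-step potential of the level-`m` composite at `Y`; composition = leaf-06's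
`blk_pow_succ_eq_of_inPair`). -/
theorem depOn_compDefectOf (hL : 0 < L) (hAv : ∀ (k : ℕ) (κ : Fin d) (z : Site d), DepOn (InPairBond L κ z) fun B => Av k B κ z)
    (hlam : ∀ (k : ℕ) (Y : Site d), DepOn (InBlockBond L Y) fun B => lam k B Y) :
    ∀ (m : ℕ) (Y : Site d), DepOn (InBlockBond (L ^ m) Y) fun A => compDefectOf Av lam L m A Y
  | 0, _ => ⟨fun _ _ _ => rfl⟩
  | m + 1, Y => by
      show DepOn _ fun A => blockSum L (compDefectOf Av lam L m A) Y + lam m (compAvOf Av m A) Y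
      refine DepOn.add ?_ ?_
      · simp only [blockSum]
        refine depOn_sum _ fun b hb => (depOn_compDefectOf hL hAv hlam m _).mono ?_
        rintro ⟨κ, y⟩ ⟨hy1, hy2⟩
        refine ⟨?_, ?_⟩
        · rw [blk_pow_succ' hL, hy1, blk_block Y hb]
        · rw [blk_pow_succ' hL, hy2, blk_block Y hb]
      · refine DepOn.comp (T := fun A => compAvOf Av m A) (PT := fun q => InPairBond (L ^ m) q.1 q.2) (hlam m Y)
          (fun q _ => depOn_compAvOf hL hAv m q.1 q.2) ?_
        rintro ⟨κ', z'⟩ ⟨h1, h2⟩ ⟨κ'', y⟩ ⟨hy1, hy2⟩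
        exact ⟨blk_pow_succ_eq_of_inPair hL hy1 h1 h2, blk_pow_succ_eq_of_inPair hL hy2 h1 h2⟩

variable (Av lam L)

/-- [folklore] `Ψ_m` pointwise: `(Ψ_m A)_α(x) = A_α(x) + |box (L^m)|⁻¹·(ζ_m A (blk (L^m) (x + e_α)) − ζ_m A (blk (L^m) x))`. -/
theorem corrPsiOf_apply (m : ℕ) (A : Form1 d ℝ) (α : Fin d) (x : Site d) :
    corrPsiOf Av lam L m A α x
      = A α x + ((box d (L ^ m)).card : ℝ)⁻¹ *
          (compDefectOf Av lam L m A (blk (L ^ m) (x + unitVec α)) - compDefectOf Av lam L m A (blk (L ^ m) x)) := by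
  simp only [corrPsiOf, Pi.add_apply, Pi.smul_apply, smul_eq_mul, dz, ext_apply]

/-- [folklore] `Φ_m` pointwise: `(Φ_m A)_α(x) = A_α(x) − |box (L^m)|⁻¹·(ζ_m A (blk (L^m) (x + e_α)) − ζ_m A (blk (L^m) x))`. -/
theorem corrPhiOf_apply (m : ℕ) (A : Form1 d ℝ) (α : Fin d) (x : Site d) :
    corrPhiOf Av lam L m A α x
      = A α x - ((box d (L ^ m)).card : ℝ)⁻¹ *
          (compDefectOf Av lam L m A (blk (L ^ m) (x + unitVec α)) - compDefectOf Av lam L m A (blk (L ^ m) x)) := by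
  simp only [corrPhiOf, Pi.sub_apply, Pi.smul_apply, smul_eq_mul, dz, ext_apply]

variable {Av lam L}

/-- [folklore] **`(Ψ_m A)_α(x)` READS ONLY THE BONDS OF `CorrReads (L^m) α x`** (generic scheme, letters (RA)(RΛ)). -/
theorem depOn_corrPsiOf (hL : 0 < L) (hAv : ∀ (k : ℕ) (κ : Fin d) (z : Site d), DepOn (InPairBond L κ z) fun B => Av k B κ z)
    (hlam : ∀ (k : ℕ) (Y : Site d), DepOn (InBlockBond L Y) fun B => lam k B Y) (m : ℕ) (α : Fin d) (x : Site d) :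
    DepOn (CorrReads (L ^ m) α x) fun A => corrPsiOf Av lam L m A α x := by
  simp only [corrPsiOf_apply]
  refine DepOn.add ((depOn_eval α x).mono fun p hp => Or.inl hp) (DepOn.mul_left _ (DepOn.sub ?_ ?_))
  · exact (depOn_compDefectOf hL hAv hlam m _).mono fun p hp => Or.inr (Or.inr hp)
  · exact (depOn_compDefectOf hL hAv hlam m _).mono fun p hp => Or.inr (Or.inl hp)

/-- [folklore] **`(Φ_m A)_α(x)` READS ONLY THE BONDS OF `CorrReads (L^m) α x`** (generic scheme, letters (RA)(RΛ)). -/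
theorem depOn_corrPhiOf (hL : 0 < L) (hAv : ∀ (k : ℕ) (κ : Fin d) (z : Site d), DepOn (InPairBond L κ z) fun B => Av k B κ z)
    (hlam : ∀ (k : ℕ) (Y : Site d), DepOn (InBlockBond L Y) fun B => lam k B Y) (m : ℕ) (α : Fin d) (x : Site d) :
    DepOn (CorrReads (L ^ m) α x) fun A => corrPhiOf Av lam L m A α x := by
  simp only [corrPhiOf_apply]
  refine DepOn.sub ((depOn_eval α x).mono fun p hp => Or.inl hp) (DepOn.mul_left _ (DepOn.sub ?_ ?_))
  · exact (depOn_compDefectOf hL hAv hlam m _).mono fun p hp => Or.inr (Or.inr hp)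
  · exact (depOn_compDefectOf hL hAv hlam m _).mono fun p hp => Or.inr (Or.inl hp)

end Generic

/-! ## §2 One (0.4) level: the straight segment and the symmetrised rooted linear average -/

/-- [folklore] **THE STRAIGHT SEGMENT OF `N` BONDS FROM THE BLOCK SITE `N•z + b` IN DIRECTION `μ` READS ONLY BONDS OF THE BLOCK PAIR `{z, z + e_μ}`** (leaf-06's `inPair_seg`). -/
theorem depOn_segUp_sum {N : ℕ} (hN : 1 ≤ N) (μ : Fin d) (z : Site d) {b : Fin d → ℕ} (hb : b ∈ box d N) :
    DepOn (InPairBond N μ z) fun A => (segUp A ((N : ℤ) • z + toSite b) μ N).sum := by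
  simp only [segUp_sum]
  refine depOn_sum _ fun s hs => (depOn_eval μ _).mono ?_
  rintro ⟨κ, y⟩ hp
  rw [Set.mem_singleton_iff, Prod.mk.injEq] at hp
  obtain ⟨h1, h2⟩ := hp
  rw [h1, h2]
  have hs' : s < N := Finset.mem_range.1 hs
  have e2 : (N : ℤ) • z + toSite b + (s : ℤ) • unitVec μ + unitVec μ = (N : ℤ) • z + toSite b + ((s + 1 : ℕ) : ℤ) • unitVec μ := by
    rw [Nat.cast_succ, add_smul, one_smul, add_assoc]
  refine ⟨inPair_seg hN z hb hs'.le, ?_⟩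
  show (N : ℤ) • z + toSite b + (s : ℤ) • unitVec μ + unitVec μ ∈ InPair N μ z
  rw [e2]
  exact inPair_seg hN z hb (Nat.succ_le_of_lt hs')

/-- [folklore] **THE SYMMETRISED ROOTED LINEAR AVERAGE AT THE COARSE BOND `(μ, z)` READS ONLY BONDS WITH BOTH ENDPOINTS IN THE BLOCK PAIR `{z, z + e_μ}`** (in-block root offset
`r ∈ box d N`): per block site `b`, the symmetrised contour integral inside the block `z` (`depOn_symAxial`), the straight segment (`depOn_segUp_sum`), and the symmetrised
contour integral inside the block `z + e_μ` (`depOn_symAxial` at `z + e_μ`) — the (0.4) twin of leaf-06's `depOn_linAvgAt`. -/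
theorem depOn_symLinAvgAt {N : ℕ} (hN : 1 ≤ N) {r : Fin d → ℕ} (hr : r ∈ box d N) (μ : Fin d) (z : Site d) :
    DepOn (InPairBond N μ z) fun B => symLinAvgAt (toSite r) B N μ z := by
  have e1 : (N : ℤ) • z + toSite r + (N : ℤ) • unitVec μ = (N : ℤ) • (z + unitVec μ) + toSite r := by rw [smul_add]; abel
  have e2 : ∀ b : Fin d → ℕ, (N : ℤ) • z + toSite b + (N : ℤ) • unitVec μ = (N : ℤ) • (z + unitVec μ) + toSite b := fun b => by
    rw [smul_add]; abel
  simp only [symLinAvgAt, e1, e2]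
  refine depOn_sum _ fun b hb => DepOn.sub (DepOn.add ?_ (DepOn.mul_left _ (depOn_segUp_sum hN μ z hb))) ?_
  · exact (depOn_symAxial hN hr z hb).mono fun p hp => ⟨inPair_of_blk_eq hp.1, inPair_of_blk_eq hp.2⟩
  · exact (depOn_symAxial hN hr (z + unitVec μ) hb).mono fun p hp => ⟨inPair_of_blk_eq_add hp.1, inPair_of_blk_eq_add hp.2⟩

/-! ## §3 The (0.4) composite: `compLinAvgSymAt`, `compDefectSymAt`, `corrPsiSym`, `corrPhiSym` -/

section Sym

variable {L : ℕ} (hL : 0 < L) {r : ℕ → (Fin d → ℕ)} (hr : ∀ k, r k ∈ box d L)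
include hL hr

/-- [folklore] THE LETTER (RA) AT THE SYM DATA: the one-step (0.4) average `avSym` at the coarse bond `(κ, z)` reads only bonds of the `L`-block pair of `z`. -/
theorem depOn_avSym (k : ℕ) (κ : Fin d) (z : Site d) :
    DepOn (InPairBond L κ z) fun B => avSym (fun k => toSite (r k)) L k B κ z := by
  simp only [avSym_apply]
  exact DepOn.mul_left _ (depOn_symLinAvgAt hL (hr k) κ z)

/-- [folklore] THE LETTER (RΛ) AT THE SYM DATA: the one-step (0.4) defect potential `lamSym = ζ_S` at the coarse site `Y` reads only bonds of the `L`-block `Y` (an2's `depOn_zetaS`). -/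
theorem depOn_lamSym (k : ℕ) (Y : Site d) :
    DepOn (InBlockBond L Y) fun B => lamSym (fun k => toSite (r k)) L k B Y := by
  simp only [lamSym_apply]
  exact depOn_zetaS hL (hr k) Y

/-- [folklore] **THE LEVEL-`k` (0.4) COMPOSITE AT THE BOND `(κ, z)` READS ONLY FINE BONDS WITH BOTH ENDPOINTS IN THE `L^k`-BLOCK PAIR `{z, z + e_κ}`** (in-block roots). -/
theorem depOn_compLinAvgSymAt (k : ℕ) (κ : Fin d) (z : Site d) :
    DepOn (InPairBond (L ^ k) κ z) fun A => compLinAvgSymAt (fun k => toSite (r k)) L k A κ z :=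
  depOn_compAvOf hL (depOn_avSym hL hr) k κ z

/-- [folklore] **THE (0.4) DEFECT POTENTIAL `ζˢ_m A Y` READS ONLY FINE BONDS WITH BOTH ENDPOINTS IN THE `L^m`-BLOCK `Y`** (in-block roots). -/
theorem depOn_compDefectSymAt (m : ℕ) (Y : Site d) :
    DepOn (InBlockBond (L ^ m) Y) fun A => compDefectSymAt (fun k => toSite (r k)) L m A Y :=
  depOn_compDefectOf hL (depOn_avSym hL hr) (depOn_lamSym hL hr) m Y

/-- [folklore] **`(Ψˢ_m A)_α(x)` READS ONLY THE BONDS OF `CorrReads (L^m) α x`** — the (0.4) composite corrector has the rooted corrector's read set (range `0` in block units). -/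
theorem depOn_corrPsiSym (m : ℕ) (α : Fin d) (x : Site d) :
    DepOn (CorrReads (L ^ m) α x) fun A => corrPsiSym r L m A α x :=
  depOn_corrPsiOf hL (depOn_avSym hL hr) (depOn_lamSym hL hr) m α x

/-- [folklore] **`(Φˢ_m A)_α(x)` READS ONLY THE BONDS OF `CorrReads (L^m) α x`.** -/
theorem depOn_corrPhiSym (m : ℕ) (α : Fin d) (x : Site d) :
    DepOn (CorrReads (L ^ m) α x) fun A => corrPhiSym r L m A α x :=
  depOn_corrPhiOf hL (depOn_avSym hL hr) (depOn_lamSym hL hr) m α x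

end Sym

end

end Summit.QuantumFields.BalabanUV.Beta.CompositeAveragingCoarseExactGeneric
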